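import Summits.Ventures.PercRepro.S2DichotomyTools
import Summits.Ventures.PercRepro.S2TailCell
import Summits.Ventures.PercRepro.S2SpanningCount
import Summits.Ventures.PercRepro.S2FlatCountTwo
import Summits.Ventures.PercRepro.S2PhiFourteenFive
import Summits.Ventures.PercRepro.S2CapFree
import Summits.Ventures.PercRepro.TriangleCapEightI
import Summits.Ventures.PercRepro.S1CoreCapSevenFinal
import Summits.Ventures.PercRepro.S1FiveCircuitBase
import Summits.Ventures.PercRepro.S2TopGraded
import Summits.Ventures.PercRepro.S2MaxExtension
import Summits.Ventures.PercRepro.S2FlatCountTwoSharp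
import Summits.Ventures.PercRepro.S2CountsCell
import Summits.Ventures.PercRepro.S2SpreadTail
import Summits.Ventures.PercRepro.S2FlatSharp
import Summits.Ventures.PercRepro.S2BasesTriangles
import Summits.Ventures.PercRepro.RankLevelSetFourCircuitNullityFour

/-!
# PercRepro — S2: THE SCALED CELL `(13, 7)` COLOOP-FREE AT `K₁ = 13034` (p7, gen 14; sub-claim S2; the `p = 14` row)

The first coloop step of the cell `(14, 7)`: on `M ＼ {e}` (an `e`-free core of rank `13` on `20` points, coloop-free) the weighted inequality
`(Φ(14,5) − 2)/2 · #U(13, 5) ≤ mid(13, 5)` by the nested dichotomy with the concentrated tail (`ν = 6, 5` full, `ν = 4` by the graded partition count) and the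
sharp spread count with the spread rank part (`gencellg7.py`). **`ThmN.c025_thirteen_seven_cfk1`**. Axioms: standard.
-/

open scoped Matroid

namespace PercRepro

namespace ThmN

open Set

variable {α : Type}

/-- The coloop-free caps at `(13, 7)`: `s₃ ≤ 11`, `s₄ ≤ 57` (`⌊20·46/16⌋`, the series-class averaging on `avgChain16 6`), `s₅ ≤ 312` (`⌊20·234/15⌋`) on every `e`-free core of nullity `7` on `20` points without coloops. -/
theorem caps_thirteen_seven_cfk1 (M : Matroid α) [M.Finite]
    (hd : M.E.encard = M.eRank + ((7 : ℕ) : ℕ∞)) (hn : M.E.ncard = 13 + 7)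
    (hfree : ∀ e ∈ M.E, ∃ A ⊆ M.E \ {e}, e ∉ M.closure A ∧ e ∉ M.closure ((M.E \ {e}) \ A)) (hK : ∀ e, ¬ M.IsColoop e) :
    {C : Set α | M.IsCircuit C ∧ C.ncard = 3}.ncard ≤ 11 ∧
      {C : Set α | M.IsCircuit C ∧ C.ncard = 4}.ncard ≤ 57 ∧
        {C : Set α | M.IsCircuit C ∧ C.ncard = 5}.ncard ≤ 312 := by
  have hs3 := TriangleCap.core_ncard_triangles_le_cq3 M hfree hd
  rw [show TriangleCap.cq3 7 = 11 by decide] at hs3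
  have hcol : M.coloops = ∅ := S2.coloops_eq_empty_of_forall_not M hK
  have hm : 20 ≤ (M.E \ M.coloops).ncard := by
    rw [hcol, Set.sdiff_empty, hn]
  have hd' : M.E.encard = M.eRank + (((6 : ℕ) : ℕ∞) + 1) := by
    rw [hd]; norm_num
  have h := S1.ncard_fourCircuits_sub_div_le_of_nonColoops M hfree hd' (by norm_num) hm (B := 46)
    (fun M' _ hfree' hd'' => by
      have h := ncard_fourCircuits_le_avgChain16 6 M' hfree' hd''
      rw [show avgChain16 6 = 46 by decide] at h
      exact h)
  have hs4 : {C : Set α | M.IsCircuit C ∧ C.ncard = 4}.ncard ≤ 57 := by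
    have := S1.le_mul_div_of_sub_div_le (by norm_num : 4 < 20) h
    omega
  have hs5 := S2.ncard_fiveCircuits_le_of_no_coloop M hfree hd' hK (by omega)
  rw [hn] at hs5
  have h5 : (13 + 7) * S1.avgChain5b 6 / (13 + 7 - 5) = 312 := by
    rw [show S1.avgChain5b 6 = 234 by decide]
  rw [h5] at hs5
  exact ⟨hs3, hs4, hs5⟩

/-- The tail side of the cell `(13, 7)` on the caps `11 / 57 / 312` with the spanning count `S` a parameter: the rank-`≤ 5` part
of the kit's tail is exactly `801207144 / 8225 = 97,411.2`, so `1024·(T + S) ≤ m·2^20` whenever `1024·(801207144 / 8225 + S) ≤ m·2^20`. -/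
theorem tail_thirteen_seven_cfk1 (S m : ℕ) (h : (1024 : ℚ) * ((801207144 / 8225 : ℚ) + (S : ℚ)) ≤ (m : ℚ) * 2 ^ 20) :
    1024 * ((((13 + 7).choose 4 : ℚ) +
      (∑ j ∈ Finset.range 6, (Nat.choose (min 5 ((7 + 3) / 2 + 1 - 2)) j : ℚ) / (((j + 1) + 3 * (j + 1).choose 2 + 3 * (j + 1).choose 3 + 2 * (j + 1).choose 4 : ℕ) : ℚ)) *
        ((11 * (13 + 7 - 3).choose 2 + 57 * (13 + 7 - 4) + 312 : ℕ) : ℚ) +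
      ((∑ j ∈ Finset.range 6, (Nat.choose 5 j : ℚ) / (((j + 1) + 3 * (j + 1).choose 2 + 3 * (j + 1).choose 3 + 2 * (j + 1).choose 4 : ℕ) : ℚ)) -
        (∑ j ∈ Finset.range 6, (Nat.choose (min 5 ((7 + 3) / 2 + 1 - 2)) j : ℚ) / (((j + 1) + 3 * (j + 1).choose 2 + 3 * (j + 1).choose 3 + 2 * (j + 1).choose 4 : ℕ) : ℚ))) *
        ((10 : ℕ).choose 5 : ℚ)) +
      (((13 + 7).choose 3 * 2 ^ 3 + (13 + 7).choose 2 * 2 + (13 + 7) + 1 : ℕ) : ℚ) +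
      (((13 + 7).choose 5 : ℚ) + (∑ j ∈ Finset.range (7), (Nat.choose (min 13 ((7 + 6) / 2 + 1 - 2)) j : ℚ) / (((j + 1) + 3 * (j + 1).choose 2 + 3 * (j + 1).choose 3 + 2 * (j + 1).choose 4 : ℕ) : ℚ)) * ((11 * (13 + 7 - 3).choose 3 + 57 * (13 + 7 - 4).choose 2 + 312 * (13 + 7 - 5) + (7 + 5).choose 6 : ℕ) : ℚ) +
        ((∑ j ∈ Finset.range (7), (Nat.choose (min 19 (5 + 7) - 6) j : ℚ) / (((j + 1) + 3 * (j + 1).choose 2 + 3 * (j + 1).choose 3 + 2 * (j + 1).choose 4 : ℕ) : ℚ)) - (∑ j ∈ Finset.range (7), (Nat.choose (min 13 ((7 + 6) / 2 + 1 - 2)) j : ℚ) / (((j + 1) + 3 * (j + 1).choose 2 + 3 * (j + 1).choose 3 + 2 * (j + 1).choose 4 : ℕ) : ℚ))) *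
        ((min 19 (5 + 7)).choose 6 : ℚ)) +
      (S : ℚ)) ≤ (m : ℚ) * 2 ^ (13 + 7) := by
  have hsm : (∑ j ∈ Finset.range (7), (Nat.choose (min 13 ((7 + 6) / 2 + 1 - 2)) j : ℚ) / (((j + 1) + 3 * (j + 1).choose 2 + 3 * (j + 1).choose 3 + 2 * (j + 1).choose 4 : ℕ) : ℚ)) = 12767 / 4230 := by
    norm_num [Finset.sum_range_succ, Nat.choose]
  have hsg : (∑ j ∈ Finset.range (7), (Nat.choose (min 19 (5 + 7) - 6) j : ℚ) / (((j + 1) + 3 * (j + 1).choose 2 + 3 * (j + 1).choose 3 + 2 * (j + 1).choose 4 : ℕ) : ℚ)) = 414767 / 103635 := by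
    norm_num [Finset.sum_range_succ, Nat.choose]
  have hs4m : (∑ j ∈ Finset.range 6, (Nat.choose (min 5 ((7 + 3) / 2 + 1 - 2)) j : ℚ) / (((j + 1) + 3 * (j + 1).choose 2 + 3 * (j + 1).choose 3 + 2 * (j + 1).choose 4 : ℕ) : ℚ)) = 523 / 225 := by
    norm_num [Finset.sum_range_succ, Nat.choose]
  have hs4g : (∑ j ∈ Finset.range 6, (Nat.choose 5 j : ℚ) / (((j + 1) + 3 * (j + 1).choose 2 + 3 * (j + 1).choose 3 + 2 * (j + 1).choose 4 : ℕ) : ℚ)) = 12767 / 4230 := by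
    norm_num [Finset.sum_range_succ, Nat.choose]
  rw [hsm, hsg, hs4m, hs4g]
  norm_num [Nat.choose] at h ⊢
  linarith

/-- the graded weights of the case `ν = 4`: `σ_lo = 7 / 5` (closures of `≤ 8` points). -/
theorem sig_thirteen_seven_cfk1_4_lo : (∑ j ∈ Finset.range (7 - 5), (Nat.choose (9 - 1 - 6) j : ℚ) / (((j + 1) + 3 * (j + 1).choose 2 + 3 * (j + 1).choose 3 + 2 * (j + 1).choose 4 : ℕ) : ℚ)) = 7 / 5 := by
  norm_num [Finset.sum_range_succ, Nat.choose]

/-- the graded weights of the case `ν = 4`: `σ_hi = 8 / 5` (the maximal closures of `9` points). -/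
theorem sig_thirteen_seven_cfk1_4_hi : (∑ j ∈ Finset.range (7 - 5), (Nat.choose (9 - 6) j : ℚ) / (((j + 1) + 3 * (j + 1).choose 2 + 3 * (j + 1).choose 3 + 2 * (j + 1).choose 4 : ℕ) : ℚ)) = 8 / 5 := by
  norm_num [Finset.sum_range_succ, Nat.choose]

/-- **The cell `(13, 7)` by the nested dichotomy with the concentrated tail**: `RLS M 13 5` on every `e`-free core of rank `13` on `20`
points (standard caps `11 / 57 / 312`, `((phiK 14 5 - 2) / 2) ≤ 2^18/13034`; the cases `ν = 6, …, 4` on `≤ 11, …, 9` points each with its own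
spanning count and slack (`full` / `pay` / `flat` / `graded` = the graded partition count), then spread with the kit's tail, slack `230/1024`). -/
theorem c025_thirteen_seven_cfk1 (M : Matroid α) [M.Finite]
    (hR : M.eRank = ((13 : ℕ) : ℕ∞)) (hn : M.E.ncard = 13 + 7)
    (hfree : ∀ e ∈ M.E, ∃ A ⊆ M.E \ {e}, e ∉ M.closure A ∧ e ∉ M.closure ((M.E \ {e}) \ A)) (hK : ∀ e, ¬ M.IsColoop e) :
    ((phiK 14 5 - 2) / 2) * (Matroid.topCount M 13 5 : ℚ) ≤ (Matroid.midCount M 13 5 : ℚ) := by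
  classical
  have hd : M.E.encard = M.eRank + ((7 : ℕ) : ℕ∞) := by
    rw [hR, ← M.ground_finite.cast_ncard_eq, hn]
    push_cast
    ring
  obtain ⟨hs3, hs4, hs5⟩ := caps_thirteen_seven_cfk1 M hd hn hfree hK
  have full : ∀ (k : ℕ) {W : Set α}, W ⊆ M.E → W.encard = M.eRk W + k →
      Matroid.topCount M 13 5 ≤ ∑ m ∈ Finset.Icc 5 7, ∑ j ∈ Finset.Icc (m + k - 7) m,
        W.ncard.choose j * (13 + 7 - W.ncard).choose (m - j) := by
    intro k W hW hWk
    refine (S2.topCount_le_sum_spanning M hR hd 5).trans ?_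
    refine Finset.sum_le_sum (fun m _ => ?_)
    have h := S2.ncard_spanning_compl_le_of_nullity M hW hd hWk (m := m)
    rw [hn] at h
    exact h
  have span : ∀ (k : ℕ) {W : Set α}, W ⊆ M.E → W.encard = M.eRk W + k →
      {X : Set α | X ⊆ M.E ∧ M.eRk X = M.eRank}.ncard ≤ ∑ m ∈ Finset.range (7 + 1), ∑ j ∈ Finset.Icc (m + k - 7) m,
        W.ncard.choose j * (13 + 7 - W.ncard).choose (m - j) := by
    intro k W hW hWk
    have h := S2.ncard_spanning_le_of_nullity M hW hd hWk
    rw [hn] at h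
    exact h
  have cell : ∀ (U S m : ℕ), Matroid.topCount M 13 5 ≤ U → {X : Set α | X ⊆ M.E ∧ M.eRk X = M.eRank}.ncard ≤ S → m ≤ 1024 →
      1024 * (U : ℚ) ≤ ((1024 - m : ℕ) : ℚ) * 2 ^ (7 - 5) * (13034 : ℚ) →
      (1024 : ℚ) * ((801207144 / 8225 : ℚ) + (S : ℚ)) ≤ (m : ℚ) * 2 ^ 20 → ((phiK 14 5 - 2) / 2) * (Matroid.topCount M 13 5 : ℚ) ≤ (Matroid.midCount M 13 5 : ℚ) := by
    intro U S m hU hS hm hpoly htail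
    exact c025_core_five_cell_of_topCount_spanning_xqictq5g M 13 7 (by norm_num) hR hn hfree 11 57 312 hs3 hs4 hs5 U hU S hS
      13034 (by norm_num) (((phiK 14 5 - 2) / 2)) (by rw [S2.phiK_fourteen_five]; norm_num) ⟨m, hm, hpoly, tail_thirteen_seven_cfk1 S m htail⟩
  have cellA : ∀ (U S m : ℕ) (A : ℚ), Matroid.topCount M 13 5 ≤ U → ({X : Set α | X ⊆ M.E ∧ M.eRk X ≤ 5}.ncard : ℚ) ≤ A → {X : Set α | X ⊆ M.E ∧ M.eRk X = M.eRank}.ncard ≤ S → m ≤ 1024 →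
      1024 * (U : ℚ) ≤ ((1024 - m : ℕ) : ℚ) * 2 ^ (7 - 5) * (13034 : ℚ) →
      (1024 : ℚ) * (A + (S : ℚ)) ≤ (m : ℚ) * 2 ^ 20 → ((phiK 14 5 - 2) / 2) * (Matroid.topCount M 13 5 : ℚ) ≤ (Matroid.midCount M 13 5 : ℚ) := by
    intro U S m A hU hA hS hm hpoly htail
    exact c025_core_five_cell_of_counts_xqictq5g M 13 7 (by norm_num) hR hn U hU A hA S hS
      13034 (by norm_num) (((phiK 14 5 - 2) / 2)) (by rw [S2.phiK_fourteen_five]; norm_num) ⟨m, hm, hpoly, htail⟩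
  by_cases h6 : ∃ W ⊆ M.E, W.ncard ≤ 11 ∧ W.encard = M.eRk W + 6
  · obtain ⟨W, hW, hWn, hWk⟩ := h6
    have hU' : Matroid.topCount M 13 5 ≤ 12540 := by
      refine (full 6 hW hWk).trans ?_
      generalize W.ncard = w at hWn ⊢
      interval_cases w <;> decide
    have hS' : {X : Set α | X ⊆ M.E ∧ M.eRk X = M.eRank}.ncard ≤ 15190 := by
      refine (span 6 hW hWk).trans ?_
      generalize W.ncard = w at hWn ⊢
      interval_cases w <;> decide
    exact cell 12540 15190 110 hU' hS' (by norm_num) (by norm_num) (by norm_num)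
  by_cases h5 : ∃ W ⊆ M.E, W.ncard ≤ 10 ∧ W.encard = M.eRk W + 5
  · obtain ⟨W, hW, hWn, hWk⟩ := h5
    have hU' : Matroid.topCount M 13 5 ≤ 33492 := by
      refine (full 5 hW hWk).trans ?_
      generalize W.ncard = w at hWn ⊢
      interval_cases w <;> decide
    have hS' : {X : Set α | X ⊆ M.E ∧ M.eRk X = M.eRank}.ncard ≤ 38158 := by
      refine (span 5 hW hWk).trans ?_
      generalize W.ncard = w at hWn ⊢
      interval_cases w <;> decide
    exact cell 33492 38158 133 hU' hS' (by norm_num) (by norm_num) (by norm_num)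
  by_cases h4 : ∃ W ⊆ M.E, W.ncard ≤ 9 ∧ W.encard = M.eRk W + 4
  · obtain ⟨W, hW, hWn, hWk⟩ := h4
    have hflat : ∀ X ⊆ M.E, M.eRk X ≤ 5 → X.ncard ≤ 9 := fun X hX hr => by
      have := S2.ncard_le_of_eRk_le_of_not_nullity M 5 10 (by norm_num) h5 hX (r := 5) (by norm_num) (by exact_mod_cast hr)
      omega
    have hflat' : ∀ X ⊆ M.E, M.eRk X ≤ 4 → X.ncard ≤ 8 := fun X hX hr => by
      have := S2.ncard_le_of_eRk_le_of_not_nullity M 5 10 (by norm_num) h5 hX (r := 4) (by norm_num) (by exact_mod_cast hr)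
      omega
    have he : ∀ P ⊆ M.E, M.closure P = P → M.eRk P = 4 → 5 ≤ P.ncard →
        ({x ∈ M.E \ P | (M.closure (insert x P)).ncard = 9}).ncard ≤ 12 := by
      intro P hP hPflat hPr hP5
      have hq : P.ncard ≤ 8 := hflat' P hP (le_of_eq hPr)
      have hPr' : M.eRk P = ((4 : ℕ) : ℕ∞) := by exact_mod_cast hPr
      by_cases hq2 : P.ncard + 2 ≤ 9
      · refine (S2.card_maxExt_le hR hn hP hPflat hPr' 9 hq2).trans ?_
        generalize P.ncard = q at hq hq2 hP5 ⊢
        interval_cases q <;> decide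
      · refine (S2.card_maxExt_le_ncard_diff P 9).trans ?_
        rw [Set.ncard_sdiff hP (M.ground_finite.subset hP), hn]
        omega
    have hV := S2.ncard_spanning_compl_le_of_nullity M hW hd hWk (m := 5)
    have hV' : ∑ j ∈ Finset.Icc (5 + 4 - 7) 5, W.ncard.choose j * (M.E.ncard - W.ncard).choose (5 - j) ≤ 12072 := by
      rw [hn]
      generalize W.ncard = w at hWn ⊢
      interval_cases w <;> decide
    have hU := topCount_le_payment_graded_of_ext M 13 7 (by norm_num) hR hn hfree 9 hflat
      11 57 312 hs3 hs4 hs5 12 he 12072 (hV.trans hV')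
    rw [sig_thirteen_seven_cfk1_4_lo, sig_thirteen_seven_cfk1_4_hi] at hU
    norm_num [Nat.choose] at hU
    have hUq : (Matroid.topCount M 13 5 : ℚ) ≤ 43837 := by linarith
    have hU' : Matroid.topCount M 13 5 ≤ 43837 := by exact_mod_cast hUq
    have hS' : {X : Set α | X ⊆ M.E ∧ M.eRk X = M.eRank}.ncard ≤ 68878 := by
      refine (span 4 hW hWk).trans ?_
      generalize W.ncard = w at hWn ⊢
      interval_cases w <;> decide
    exact cell 43837 68878 163 hU' hS' (by norm_num) (by norm_num) (by norm_num)
  · -- spread: rank-`5` sets `≤ 8`, rank-`4` sets `≤ 7`; the sharp count with the spread rank part (`≤ 11` triangles against the kit's spanning bound, `≥ 12` against three triangles' Bonferroni)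
    have hflat : ∀ X ⊆ M.E, M.eRk X ≤ 5 → X.ncard ≤ 8 := fun X hX hr => by
      have := S2.ncard_le_of_eRk_le_of_not_nullity M 4 9 (by norm_num) h4 hX (r := 5) (by norm_num) (by exact_mod_cast hr)
      omega
    have hflat' : ∀ X ⊆ M.E, M.eRk X ≤ 4 → X.ncard ≤ 7 := fun X hX hr => by
      have := S2.ncard_le_of_eRk_le_of_not_nullity M 4 9 (by norm_num) h4 hX (r := 4) (by norm_num) (by exact_mod_cast hr)
      omega
    have hEcard : M.ground_finite.toFinset.card = 13 + 7 := by
      rw [← Set.ncard_eq_toFinset_card _ M.ground_finite]; exact hn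
    by_cases ht : {C : Set α | M.IsCircuit C ∧ C.ncard = 3}.ncard ≤ 11
    · have hU := topCount_le_flat_sharp M 13 7 (by norm_num) (by norm_num) hR hn hfree 8 7 hflat hflat' (by norm_num) (by norm_num)
        11 57 312 ht hs4 hs5
      norm_num [Finset.sum_range_succ, Nat.choose] at hU
      have hUq : (Matroid.topCount M 13 5 : ℚ) ≤ 41957 := by linarith
      have hU' : Matroid.topCount M 13 5 ≤ 41957 := by exact_mod_cast hUq
      have hA := ncard_eRk_le_five_le_spread M 13 7 (by norm_num) hR hn hfree hflat hflat' 11 57 312 hs3 hs4 hs5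
      have hS := Matroid.ncard_spanning_le (M := M) hd
      rw [hEcard] at hS
      have hS' : {X : Set α | X ⊆ M.E ∧ M.eRk X = M.eRank}.ncard ≤ 137980 := hS.trans (by decide)
      exact cellA 41957 137980 197 _ hU' hA hS' (by norm_num) (by norm_num) (by norm_num [Nat.choose])
    · push Not at ht
      have hU := topCount_le_flat_sharp M 13 7 (by norm_num) (by norm_num) hR hn hfree 8 7 hflat hflat' (by norm_num) (by norm_num)
        11 57 312 hs3 hs4 hs5
      norm_num [Finset.sum_range_succ, Nat.choose] at hU
      have hUq : (Matroid.topCount M 13 5 : ℚ) ≤ 41957 := by linarith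
      have hU' : Matroid.topCount M 13 5 ≤ 41957 := by exact_mod_cast hUq
      have hA := ncard_eRk_le_five_le_spread M 13 7 (by norm_num) hR hn hfree hflat hflat' 11 57 312 hs3 hs4 hs5
      have hL0 : ∀ e ∈ M.E, ¬ M.IsLoop e := not_isLoop_of_free M hfree
      have hs : ∀ e ∈ M.E, ∀ f ∈ M.E, e ≠ f → M.eRk {e, f} = 2 := by
        intro e he f hf hef
        have h2 : (2 : ℕ∞) ≤ M.eRk {e, f} :=
          two_le_eRk_of_two_le_ncard_of_free M hfree (pair_subset he hf) (by rw [ncard_pair hef])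
        have h3 : M.eRk {e, f} ≤ 2 := by
          have := M.eRk_le_encard {e, f}
          rwa [encard_pair hef] at this
        exact le_antisymm h3 h2
      have hC1 : ∀ L ⊆ M.E, M.eRk L = 2 → L.ncard ≤ 3 :=
        fun L hL hr => ncard_le_three_of_eRk_two M hs hfree hL hr
      have hTfin : {C : Set α | M.IsCircuit C ∧ C.ncard = 3}.Finite :=
        M.ground_finite.finite_subsets.subset (fun C hC => hC.1.subset_ground)
      obtain ⟨T₁, T₂, T₃, hT₁, hT₂, hT₃, h12, h13, h23⟩ := (Set.two_lt_ncard_iff hTfin).1 (by omega)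
      have hS := S2.ncard_spanning_add_le_of_three_triangles M hR hn (by norm_num) hC1 hT₁.1 hT₁.2 hT₂.1 hT₂.2 hT₃.1 hT₃.2 h12 h13 h23
      norm_num [Finset.sum_range_succ, Nat.choose] at hS
      have hS' : {X : Set α | X ⊆ M.E ∧ M.eRk X = M.eRank}.ncard ≤ 98941 := by omega
      exact cellA 41957 98941 159 _ hU' hA hS' (by norm_num) (by norm_num) (by norm_num [Nat.choose])

end ThmN

end PercRepro
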